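/-
Copyright: pub-balaban β-flow team, β-FLOW PROVER 4 (unit `b2b-balaban-beta-bflow-p4`, gen 7; coordinator ruling «YM
ACCELERATION» 2026-08-21 item (2), «work behind the as-printed interface»).  NON-VACUITY WITNESS for PART 17b: the free
lattice Maxwell kernel (an2's `maxwellKernelZ`, halved) IS the Hessian kernel of the unit-weight curl form on finitely supported
fields of `ℤ^d` — so the hypotheses (N-adm), (N-curl), `Definitions.d365` ∕ `d367` and [I] (5.8)–(5.10), (1.21) of PART 17b are
jointly inhabited by a `Setting` with a NON-ZERO vacuum polarization, ζ = 1 = its mixed second moment.  [folklore] lattice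
calculus; nothing of Bałaban's model asserted; NOT BetaPertH, NOT continuum, NOT Clay.
-/
import Mathlib
import Literature.MathematicalPhysics.QuantumFieldTheory.Balaban1983to89.Beta.PolarizationWitnessZd
import Summits.QuantumFields.BalabanUV.Beta.EriceTentCalculus

/-!
# `Beta.EriceZetaIdentificationWitness` — PART 17c of the `EriceLoopExpansionD4` series: the Maxwell kernel is the Hessian of
# the curl form on `ℤ^d` (non-vacuity of PART 17b's hypotheses)

[folklore] throughout.  an2's explicit infinite-volume Maxwell kernel `PolarizationWitnessZd.maxwellKernelZ d` («the
`−Δδ_{μν} + ∂_μ∂_ν^*` structure of the free lattice Maxwell operator, doubled»; Ward transversality, index symmetry, reflection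
covariance, (5.10)-decay, summable moments and `secondMoment = 2` PROVED there) satisfies, for every finitely supported
`f : ℤ^d → (Fin d → ℝ)`:
  `½ Σ_{x,μ} Σ_{y,ν} f_μ(x) · ½Π^ℤ_{μν}(x − y) · f_ν(y) = ¼ Σ_x Σ_{μ,ν} (f_μ(x) + f_ν(x+e_μ) − f_μ(x+e_ν) − f_ν(x))²`
(`maxwell_form_eq_curl_form`) — summation by parts on `ℤ^d` (PART 17a §1's shift invariance).  Hence (PART 17d
`Beta.EriceZetaIdentificationWitnessEnd`, the interface side) a `BetaFlowAsPrinted.Setting` with `vacPol := ½Π^ℤ`, `quad` := the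
(3.67) double sum, `halfCurlSq` := the unit-weight curl form, `adm := univ`, `ζ := 1` satisfies `Definitions` and every hypothesis
of PART 17b's `zeta_eq_secondMoment_of_365_367`, whose conclusion there reads `1 = secondMoment (½Π^ℤ) μ ν` — consistent with an2's
`secondMoment_maxwellKernelZ = 2`, an independent check of the normalisation PART 17b pins.  Nothing of Bałaban's Π^{(j)} is
asserted (Π^ℤ is the g → 0 caricature only as CONTEXT); NOT BetaPertH, NOT continuum, NOT Clay.
-/

namespace Summit.QuantumFields.BalabanUV.Beta.EriceZetaIdentificationWitness

open Literature.MathematicalPhysics.QuantumFieldTheory.Balaban1983to89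
open Literature.MathematicalPhysics.QuantumFieldTheory.Balaban1983to89.Beta
open Literature.MathematicalPhysics.QuantumFieldTheory.Balaban1983to89.Beta.PolarizationWitnessZd
open Literature.MathematicalPhysics.QuantumFieldTheory.Balaban1983to89.B6BondElimination (unitVec unitVec_apply)
open Summit.QuantumFields.BalabanUV.Beta.EriceTentCalculus (tsum_add_shift tsum_sub_shift)
open scoped BigOperators

variable {d : ℕ}

/-! ## §1. Delta kernels act by evaluation -/

/-- `Σ_y δ(x − y + v)·g(y) = g(x + v)`. [folklore] -/
theorem tsum_zdelta_sub_add_mul (x v : Fin d → ℤ) (g : (Fin d → ℤ) → ℝ) :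
    ∑' y, zdelta (x - y + v) * g y = g (x + v) := by
  rw [tsum_eq_single (x + v)]
  · simp [zdelta]
  · intro y hy
    rw [zdelta_of_ne (fun h => hy (by have := congrArg (fun w => y + w) h; simpa [sub_add, add_comm, add_left_comm] using this.symm)),
      zero_mul]

/-- `Σ_y δ(x − y)·g(y) = g(x)`. [folklore] -/
theorem tsum_zdelta_sub_mul (x : Fin d → ℤ) (g : (Fin d → ℤ) → ℝ) : ∑' y, zdelta (x - y) * g y = g x := by
  have h := tsum_zdelta_sub_add_mul x 0 g
  simpa using h

/-- `Σ_y δ(x − y − v)·g(y) = g(x − v)`. [folklore] -/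
theorem tsum_zdelta_sub_sub_mul (x v : Fin d → ℤ) (g : (Fin d → ℤ) → ℝ) :
    ∑' y, zdelta (x - y - v) * g y = g (x - v) := by
  have h := tsum_zdelta_sub_add_mul x (-v) g
  simpa [sub_eq_add_neg] using h

/-- Summability of a delta kernel against any weight (one-point support). [folklore] -/
theorem summable_zdelta_sub_add_mul (x v : Fin d → ℤ) (g : (Fin d → ℤ) → ℝ) :
    Summable fun y => zdelta (x - y + v) * g y :=
  summable_of_ne_finset_zero (s := {x + v}) fun y hy => by
    rw [Finset.mem_singleton] at hy
    rw [zdelta_of_ne (fun h => hy (by rw [sub_add_eq_add_sub, sub_eq_zero] at h; exact h.symm)), zero_mul]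

/-- Summability, `v = 0` form. [folklore] -/
theorem summable_zdelta_sub_mul (x : Fin d → ℤ) (g : (Fin d → ℤ) → ℝ) : Summable fun y => zdelta (x - y) * g y :=
  summable_of_ne_finset_zero (s := {x}) fun y hy => by
    rw [Finset.mem_singleton] at hy
    rw [zdelta_of_ne (fun h => hy (sub_eq_zero.mp h).symm), zero_mul]

/-- Summability, `− v` form. [folklore] -/
theorem summable_zdelta_sub_sub_mul (x v : Fin d → ℤ) (g : (Fin d → ℤ) → ℝ) :
    Summable fun y => zdelta (x - y - v) * g y :=
  summable_of_ne_finset_zero (s := {x - v}) fun y hy => by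
    rw [Finset.mem_singleton] at hy
    rw [zdelta_of_ne (fun h => hy (by rw [sub_sub, sub_eq_zero] at h; rw [h]; abel)), zero_mul]

/-- Summability of the correlator against any weight (four delta terms). [folklore] -/
theorem summable_zddCorr_sub_mul (ν μ : Fin d) (x : Fin d → ℤ) (g : (Fin d → ℤ) → ℝ) :
    Summable fun y => zddCorr ν μ (x - y) * g y := by
  have e : ∀ y, zddCorr ν μ (x - y) * g y = zdelta (x - y + (unitVec μ - unitVec ν)) * g y
      - zdelta (x - y - unitVec ν) * g y - zdelta (x - y + unitVec μ) * g y + zdelta (x - y) * g y := fun y => by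
    simp only [zddCorr, add_sub_assoc]; ring
  simp_rw [e]
  exact (((summable_zdelta_sub_add_mul x _ g).sub (summable_zdelta_sub_sub_mul x _ g)).sub
    (summable_zdelta_sub_add_mul x _ g)).add (summable_zdelta_sub_mul x g)

/-- The diagonal correlator acts as the negative second difference: `Σ_y C_{κκ}(x − y)·g(y) = 2g(x) − g(x − e_κ) − g(x + e_κ)`.
[folklore] -/
theorem tsum_zddCorr_diag_mul (κ : Fin d) (x : Fin d → ℤ) (g : (Fin d → ℤ) → ℝ) :
    ∑' y, zddCorr κ κ (x - y) * g y = 2 * g x - g (x - unitVec κ) - g (x + unitVec κ) := by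
  have hs0 := summable_zdelta_sub_mul x g
  have hs1 := summable_zdelta_sub_sub_mul x (unitVec κ) g
  have hs2 := summable_zdelta_sub_add_mul x (unitVec κ) g
  have e : ∀ y, zddCorr κ κ (x - y) * g y = zdelta (x - y) * g y - zdelta (x - y - unitVec κ) * g y
      - zdelta (x - y + unitVec κ) * g y + zdelta (x - y) * g y := fun y => by
    simp only [zddCorr, add_sub_cancel_right]; ring
  simp_rw [e]
  rw [((hs0.sub hs1).sub hs2).tsum_add hs0, (hs0.sub hs1).tsum_sub hs2, hs0.tsum_sub hs1,
    tsum_zdelta_sub_mul, tsum_zdelta_sub_sub_mul, tsum_zdelta_sub_add_mul]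
  ring

/-- The off-diagonal correlator: `Σ_y C_{νμ}(x − y)·g(y) = g(x + e_μ − e_ν) − g(x − e_ν) − g(x + e_μ) + g(x)`. [folklore] -/
theorem tsum_zddCorr_mul (ν μ : Fin d) (x : Fin d → ℤ) (g : (Fin d → ℤ) → ℝ) :
    ∑' y, zddCorr ν μ (x - y) * g y = g (x + unitVec μ - unitVec ν) - g (x - unitVec ν) - g (x + unitVec μ) + g x := by
  have hs0 := summable_zdelta_sub_mul x g
  have hs1 := summable_zdelta_sub_sub_mul x (unitVec ν) g
  have hs2 := summable_zdelta_sub_add_mul x (unitVec μ) g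
  have hs3 := summable_zdelta_sub_add_mul x (unitVec μ - unitVec ν) g
  have e : ∀ y, zddCorr ν μ (x - y) * g y = zdelta (x - y + (unitVec μ - unitVec ν)) * g y
      - zdelta (x - y - unitVec ν) * g y - zdelta (x - y + unitVec μ) * g y + zdelta (x - y) * g y := fun y => by
    simp only [zddCorr, add_sub_assoc]; ring
  simp_rw [e]
  rw [((hs3.sub hs1).sub hs2).tsum_add hs0, (hs3.sub hs1).tsum_sub hs2, hs3.tsum_sub hs1,
    tsum_zdelta_sub_mul, tsum_zdelta_sub_sub_mul, tsum_zdelta_sub_add_mul, tsum_zdelta_sub_add_mul, add_sub_assoc]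

/-! ## §2. Summation by parts on an additive group (finitely supported `g`) -/

section SBP

variable {G : Type*} [AddCommGroup G]

/-- `Σ_x g(x)(2g(x) − g(x − e) − g(x + e)) = Σ_x (g(x + e) − g(x))²`. [folklore] -/
theorem tsum_mul_negLaplace_eq {g : G → ℝ} {s : Finset G} (hg : ∀ x ∉ s, g x = 0) (e : G) :
    ∑' x, g x * (2 * g x - g (x - e) - g (x + e)) = ∑' x, (g (x + e) - g x) ^ 2 := by
  classical
  have h1 : Summable fun x => g x ^ 2 := summable_of_ne_finset_zero (s := s) fun x hx => by simp [hg x hx]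
  have h2 : Summable fun x => g x * g (x + e) := summable_of_ne_finset_zero (s := s) fun x hx => by simp [hg x hx]
  have h3 : Summable fun x => g x * g (x - e) := summable_of_ne_finset_zero (s := s) fun x hx => by simp [hg x hx]
  have h4 : Summable fun x => g (x + e) ^ 2 := by
    have := (Equiv.addRight e).summable_iff.mpr h1; exact this.congr fun x => by simp
  have eL : ∀ x, g x * (2 * g x - g (x - e) - g (x + e)) = 2 * g x ^ 2 - g x * g (x - e) - g x * g (x + e) := fun x => by ring
  have eR : ∀ x, (g (x + e) - g x) ^ 2 = g (x + e) ^ 2 + g x ^ 2 - 2 * (g x * g (x + e)) := fun x => by ring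
  simp_rw [eL, eR]
  rw [((h1.mul_left 2).sub h3).tsum_sub h2, (h1.mul_left 2).tsum_sub h3, tsum_mul_left,
    (h4.add h1).tsum_sub (h2.mul_left 2), h4.tsum_add h1, tsum_mul_left,
    tsum_add_shift (fun x => g x ^ 2) e]
  have : ∑' x, g x * g (x - e) = ∑' x, g x * g (x + e) := by
    rw [← tsum_add_shift (fun x => g x * g (x - e)) e]; simp [mul_comm]
  rw [this]; ring

/-- `Σ_x g(x)(h(x + a − b) − h(x − b) − h(x + a) + h(x)) = Σ_x (g(x + b) − g(x))·(h(x + a) − h(x))`. [folklore] -/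
theorem tsum_mul_mixed_eq {g : G → ℝ} {s : Finset G} (hg : ∀ x ∉ s, g x = 0) (h : G → ℝ) (a b : G) :
    ∑' x, g x * (h (x + a - b) - h (x - b) - h (x + a) + h x) = ∑' x, (g (x + b) - g x) * (h (x + a) - h x) := by
  classical
  have hs : ∀ φ : G → ℝ, Summable fun x => g x * φ x := fun φ =>
    summable_of_ne_finset_zero (s := s) fun x hx => by simp [hg x hx]
  have hs' : ∀ φ : G → ℝ, Summable fun x => g (x + b) * φ x := fun φ =>
    summable_of_ne_finset_zero (s := s.image (· - b)) fun x hx => by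
      have : x + b ∉ s := fun h' => hx (Finset.mem_image.mpr ⟨x + b, h', by simp⟩)
      simp [hg _ this]
  have eL : ∀ x, g x * (h (x + a - b) - h (x - b) - h (x + a) + h x)
      = (g x * h (x + a - b) - g x * h (x - b)) - (g x * h (x + a) - g x * h x) := fun x => by ring
  have eR : ∀ x, (g (x + b) - g x) * (h (x + a) - h x)
      = (g (x + b) * h (x + a) - g (x + b) * h x) - (g x * h (x + a) - g x * h x) := fun x => by ring
  simp_rw [eL, eR]
  rw [((hs _).sub (hs _)).tsum_sub ((hs _).sub (hs _)), ((hs' _).sub (hs' _)).tsum_sub ((hs _).sub (hs _)),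
    (hs _).tsum_sub (hs _), (hs' _).tsum_sub (hs' _)]
  congr 1
  rw [← tsum_add_shift (fun x => g x * h (x + a - b)) b, ← tsum_add_shift (fun x => g x * h (x - b)) b]
  have e3 : ∀ x : G, x + b + a - b = x + a := fun x => by abel
  have e4 : ∀ x : G, x + b - b = x := fun x => by abel
  simp only [e3, e4]

end SBP

/-! ## §3. The Maxwell kernel is the Hessian kernel of the unit-weight curl form -/

section Maxwell

/-- The halved Maxwell kernel acting on a component: `Σ_y ½Π^ℤ_{μν}(x − y)·g(y) = [μ = ν]·Σ_κ (2g(x) − g(x−e_κ) − g(x+e_κ)) −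
(g(x + e_μ − e_ν) − g(x − e_ν) − g(x + e_μ) + g(x))` (the `−Δδ_{μν} + ∂_μ∂*_ν` structure). [folklore] -/
theorem tsum_halfMaxwell_mul (μ ν : Fin d) (x : Fin d → ℤ) (g : (Fin d → ℤ) → ℝ) :
    ∑' y, (1 / 2 * maxwellKernelZ d μ ν (x - y)) * g y
      = (if μ = ν then ∑ κ, (2 * g x - g (x - unitVec κ) - g (x + unitVec κ)) else 0)
        - (g (x + unitVec μ - unitVec ν) - g (x - unitVec ν) - g (x + unitVec μ) + g x) := by
  classical
  have e : ∀ y, (1 / 2 * maxwellKernelZ d μ ν (x - y)) * g y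
      = (if μ = ν then ∑ κ, zddCorr κ κ (x - y) * g y else 0) - zddCorr ν μ (x - y) * g y := fun y => by
    rw [maxwellKernelZ_apply]
    split_ifs
    · rw [← Finset.sum_mul]; ring
    · ring
  simp_rw [e]
  have hs1 : ∀ κ, Summable fun y => zddCorr κ κ (x - y) * g y := fun κ => summable_zddCorr_sub_mul κ κ x g
  have hs2 : Summable fun y => zddCorr ν μ (x - y) * g y := summable_zddCorr_sub_mul ν μ x g
  by_cases h : μ = ν
  · subst h
    simp only [if_true]
    rw [(summable_sum fun κ _ => hs1 κ).tsum_sub hs2, Summable.tsum_finsetSum fun κ _ => hs1 κ]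
    simp_rw [tsum_zddCorr_diag_mul]
    simp only [add_sub_cancel_right]
    ring
  · simp only [h, if_false, zero_sub]
    rw [tsum_neg, tsum_zddCorr_mul]

/-- **THE MAXWELL KERNEL IS THE HESSIAN KERNEL OF THE UNIT-WEIGHT CURL FORM on `ℤ^d`**: for a finitely supported
`f : ℤ^d → (Fin d → ℝ)` (support in `W`),
`½ Σ_{x,μ} Σ_{y,ν} f_μ(x)·½Π^ℤ_{μν}(x − y)·f_ν(y) = ¼ Σ_x Σ_{μ,ν} (f_μ(x) + f_ν(x+e_μ) − f_μ(x+e_ν) − f_ν(x))²`. [folklore] -/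
theorem maxwell_form_eq_curl_form (f : (Fin d → ℤ) → Fin d → ℝ) {W : Finset (Fin d → ℤ)}
    (hf : ∀ x ∉ W, ∀ μ, f x μ = 0) :
    (1 / 2) * ∑ x ∈ W, ∑ μ, ∑ y ∈ W, ∑ ν, f x μ * (1 / 2 * maxwellKernelZ d μ ν (x - y)) * f y ν
      = (1 / 4) * ∑' x, ∑ μ, ∑ ν, (f x μ + f (x + unitVec μ) ν - f (x + unitVec ν) μ - f x ν) ^ 2 := by
  classical
  -- summability helpers: anything with a factor f_μ(x) or f_μ(x + e) is finitely supported
  have hsW : ∀ (μ : Fin d) (φ : (Fin d → ℤ) → ℝ), Summable fun x => f x μ * φ x := fun μ φ =>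
    summable_of_ne_finset_zero (s := W) fun x hx => by simp [hf x hx μ]
  have hsW' : ∀ (μ : Fin d) (e : Fin d → ℤ) (φ : (Fin d → ℤ) → ℝ), Summable fun x => f (x + e) μ * φ x :=
    fun μ e φ => summable_of_ne_finset_zero (s := W.image (· - e)) fun x hx => by
      have : x + e ∉ W := fun h' => hx (Finset.mem_image.mpr ⟨x + e, h', by simp⟩)
      simp [hf _ this μ]
  have hsU : ∀ (μ ν : Fin d) (φ : (Fin d → ℤ) → ℝ),
      Summable fun x => (f (x + unitVec ν) μ - f x μ) * φ x := fun μ ν φ => by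
    have := (hsW' μ (unitVec ν) φ).sub (hsW μ φ)
    exact this.congr fun x => by ring
  -- the inner y-sum through `tsum_halfMaxwell_mul`
  have hinner : ∀ x μ ν, ∑ y ∈ W, f x μ * (1 / 2 * maxwellKernelZ d μ ν (x - y)) * f y ν
      = f x μ * ((if μ = ν then ∑ κ, (2 * f x ν - f (x - unitVec κ) ν - f (x + unitVec κ) ν) else 0)
          - (f (x + unitVec μ - unitVec ν) ν - f (x - unitVec ν) ν - f (x + unitVec μ) ν + f x ν)) := by
    intro x μ ν
    have e1 : ∑' y, (1 / 2 * maxwellKernelZ d μ ν (x - y)) * f y ν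
        = ∑ y ∈ W, (1 / 2 * maxwellKernelZ d μ ν (x - y)) * f y ν :=
      tsum_eq_sum fun y hy => by rw [hf y hy ν, mul_zero]
    have e2 := tsum_halfMaxwell_mul μ ν x (fun y => f y ν)
    rw [← e2, e1, Finset.mul_sum]
    exact Finset.sum_congr rfl fun y _ => by ring
  -- LHS = ½ Σ_μ Σ_ν Σ'_x f_μ(x)·inner
  have hL : ∑ x ∈ W, ∑ μ, ∑ y ∈ W, ∑ ν, f x μ * (1 / 2 * maxwellKernelZ d μ ν (x - y)) * f y ν
      = ∑ μ, ∑ ν, ∑' x, f x μ * ((if μ = ν then ∑ κ, (2 * f x ν - f (x - unitVec κ) ν - f (x + unitVec κ) ν) else 0)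
          - (f (x + unitVec μ - unitVec ν) ν - f (x - unitVec ν) ν - f (x + unitVec μ) ν + f x ν)) := by
    have e3 : ∀ x μ, ∑ y ∈ W, ∑ ν, f x μ * (1 / 2 * maxwellKernelZ d μ ν (x - y)) * f y ν
        = ∑ ν, ∑ y ∈ W, f x μ * (1 / 2 * maxwellKernelZ d μ ν (x - y)) * f y ν := fun x μ => Finset.sum_comm
    simp_rw [e3, hinner]
    rw [Finset.sum_comm]
    refine Finset.sum_congr rfl fun μ _ => ?_
    rw [Finset.sum_comm]
    refine Finset.sum_congr rfl fun ν _ => ?_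
    exact (tsum_eq_sum (s := W) fun x hx => by rw [hf x hx μ, zero_mul]).symm
  -- split inner into the diagonal (Laplace) and the mixed part, summed by parts
  have hsplit : ∀ μ ν, ∑' x, f x μ * ((if μ = ν then ∑ κ, (2 * f x ν - f (x - unitVec κ) ν - f (x + unitVec κ) ν) else 0)
          - (f (x + unitVec μ - unitVec ν) ν - f (x - unitVec ν) ν - f (x + unitVec μ) ν + f x ν))
      = (if μ = ν then ∑ κ, ∑' x, (f (x + unitVec κ) μ - f x μ) ^ 2 else 0)
        - ∑' x, (f (x + unitVec ν) μ - f x μ) * (f (x + unitVec μ) ν - f x ν) := by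
    intro μ ν
    have hm : ∑' x, f x μ * (f (x + unitVec μ - unitVec ν) ν - f (x - unitVec ν) ν - f (x + unitVec μ) ν + f x ν)
        = ∑' x, (f (x + unitVec ν) μ - f x μ) * (f (x + unitVec μ) ν - f x ν) :=
      tsum_mul_mixed_eq (g := fun x => f x μ) (fun x hx => hf x hx μ) (fun x => f x ν) (unitVec μ) (unitVec ν)
    by_cases h : μ = ν
    · subst h
      simp only [if_true]
      have e6 : ∀ x, f x μ * ((∑ κ, (2 * f x μ - f (x - unitVec κ) μ - f (x + unitVec κ) μ))
          - (f (x + unitVec μ - unitVec μ) μ - f (x - unitVec μ) μ - f (x + unitVec μ) μ + f x μ))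
          = (∑ κ, f x μ * (2 * f x μ - f (x - unitVec κ) μ - f (x + unitVec κ) μ))
            - f x μ * (f (x + unitVec μ - unitVec μ) μ - f (x - unitVec μ) μ - f (x + unitVec μ) μ + f x μ) :=
        fun x => by rw [mul_sub, Finset.mul_sum]
      simp_rw [e6]
      rw [(summable_sum fun κ _ => hsW μ _).tsum_sub (hsW μ _), hm, Summable.tsum_finsetSum fun κ _ => hsW μ _]
      congr 1
      exact Finset.sum_congr rfl fun κ _ =>
        tsum_mul_negLaplace_eq (g := fun x => f x μ) (fun x hx => hf x hx μ) (unitVec κ)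
    · simp only [h, if_false, zero_sub, mul_neg, tsum_neg, hm]
  -- RHS: expand the square and swap sums
  have hsq : ∀ x μ ν, (f x μ + f (x + unitVec μ) ν - f (x + unitVec ν) μ - f x ν) ^ 2
      = (f (x + unitVec ν) μ - f x μ) * (f (x + unitVec ν) μ - f x μ)
        + (f (x + unitVec μ) ν - f x ν) * (f (x + unitVec μ) ν - f x ν)
        - 2 * ((f (x + unitVec ν) μ - f x μ) * (f (x + unitVec μ) ν - f x ν)) := fun x μ ν => by ring
  have hsF : ∀ μ ν, Summable fun x => (f x μ + f (x + unitVec μ) ν - f (x + unitVec ν) μ - f x ν) ^ 2 := by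
    intro μ ν
    simp_rw [hsq]
    exact ((hsU μ ν _).add (hsU ν μ _)).sub ((hsU μ ν _).mul_left 2)
  have hR : ∑' x, ∑ μ, ∑ ν, (f x μ + f (x + unitVec μ) ν - f (x + unitVec ν) μ - f x ν) ^ 2
      = 2 * ∑ μ, ∑ ν, ∑' x, (f (x + unitVec ν) μ - f x μ) ^ 2
        - 2 * ∑ μ, ∑ ν, ∑' x, (f (x + unitVec ν) μ - f x μ) * (f (x + unitVec μ) ν - f x ν) := by
    rw [Summable.tsum_finsetSum fun μ _ => summable_sum fun ν _ => hsF μ ν]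
    simp_rw [Summable.tsum_finsetSum fun ν _ => hsF _ ν]
    simp_rw [hsq]
    have e4 : ∀ μ ν, ∑' x, ((f (x + unitVec ν) μ - f x μ) * (f (x + unitVec ν) μ - f x μ)
        + (f (x + unitVec μ) ν - f x ν) * (f (x + unitVec μ) ν - f x ν)
        - 2 * ((f (x + unitVec ν) μ - f x μ) * (f (x + unitVec μ) ν - f x ν)))
        = ∑' x, (f (x + unitVec ν) μ - f x μ) ^ 2 + ∑' x, (f (x + unitVec μ) ν - f x ν) ^ 2
          - 2 * ∑' x, (f (x + unitVec ν) μ - f x μ) * (f (x + unitVec μ) ν - f x ν) := by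
      intro μ ν
      rw [((hsU μ ν _).add (hsU ν μ _)).tsum_sub ((hsU μ ν _).mul_left 2), (hsU μ ν _).tsum_add (hsU ν μ _),
        tsum_mul_left]
      congr 2 <;> exact tsum_congr fun x => by ring
    simp_rw [e4, Finset.sum_sub_distrib, Finset.sum_add_distrib, ← Finset.mul_sum]
    have e5 : ∑ μ, ∑ ν, ∑' x, (f (x + unitVec μ) ν - f x ν) ^ 2 = ∑ μ, ∑ ν, ∑' x, (f (x + unitVec ν) μ - f x μ) ^ 2 :=
      Finset.sum_comm
    rw [e5]; ring
  -- assemble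
  rw [hL, hR]
  simp_rw [hsplit, Finset.sum_sub_distrib]
  rw [Finset.sum_congr rfl fun μ _ => Finset.sum_ite_eq Finset.univ μ _]
  simp only [Finset.mem_univ, if_true]
  ring

end Maxwell

/-! ## §4. Axis-permutation covariance (1.21) of the Maxwell kernel -/

section Perm

/-- `e_{σμ} = e_μ ∘ σ⁻¹`. [folklore] -/
theorem unitVec_perm (σ : Equiv.Perm (Fin d)) (μ : Fin d) : (unitVec (σ μ) : Fin d → ℤ) = unitVec μ ∘ σ.symm := by
  funext i
  simp only [unitVec_apply, Function.comp_apply, Equiv.symm_apply_eq]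

/-- `δ(y ∘ σ⁻¹) = δ(y)`. [folklore] -/
theorem zdelta_comp_perm (σ : Equiv.Perm (Fin d)) (y : Fin d → ℤ) : zdelta (y ∘ σ.symm) = zdelta y := by
  unfold zdelta
  have : (y ∘ σ.symm = 0) ↔ y = 0 := by
    constructor
    · intro h; funext i; have := congrFun h (σ i); simpa using this
    · intro h; subst h; rfl
  simp only [this]

/-- `C_{σν,σμ}(x ∘ σ⁻¹) = C_{νμ}(x)`. [folklore] -/
theorem zddCorr_perm (σ : Equiv.Perm (Fin d)) (ν μ : Fin d) (x : Fin d → ℤ) :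
    zddCorr (σ ν) (σ μ) (x ∘ σ.symm) = zddCorr ν μ x := by
  unfold zddCorr
  rw [unitVec_perm, unitVec_perm]
  have e1 : x ∘ σ.symm + unitVec μ ∘ σ.symm - unitVec ν ∘ σ.symm = (x + unitVec μ - unitVec ν) ∘ σ.symm := rfl
  have e2 : x ∘ σ.symm - unitVec ν ∘ σ.symm = (x - unitVec ν) ∘ σ.symm := rfl
  have e3 : x ∘ σ.symm + unitVec μ ∘ σ.symm = (x + unitVec μ) ∘ σ.symm := rfl
  rw [e1, e2, e3, zdelta_comp_perm, zdelta_comp_perm, zdelta_comp_perm, zdelta_comp_perm]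

/-- **(1.21) for the Maxwell kernel**: `Π^ℤ` is covariant under the permutations of the lattice axes. [folklore] -/
theorem permCovariant_maxwellKernelZ : B12Beta.PermCovariant (maxwellKernelZ d) := by
  intro σ μ ν x
  rw [maxwellKernelZ_apply, maxwellKernelZ_apply]
  have hinj : (σ μ = σ ν) ↔ μ = ν := σ.injective.eq_iff
  simp only [hinj, zddCorr_perm]
  congr 2
  split_ifs
  · exact (Equiv.sum_comp σ (fun κ => zddCorr κ κ (x ∘ σ.symm))).symm.trans
      (Finset.sum_congr rfl fun κ _ => zddCorr_perm σ κ κ x) |>.symm.symm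
  · rfl

/-- Covariance is preserved by scalars. [folklore] -/
theorem permCovariant_smul {P : B12Beta.Kernel d} (h : B12Beta.PermCovariant P) (c : ℝ) :
    B12Beta.PermCovariant (fun μ ν z => c * P μ ν z) := fun σ μ ν x => by
  simp only [h σ μ ν x]

end Perm

end Summit.QuantumFields.BalabanUV.Beta.EriceZetaIdentificationWitness
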